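import Summits.ValiantsHypothesis.ValiantsHypothesis.Theorems.SymPencilPerFourInnerRankTen
import Summits.ValiantsHypothesis.ValiantsHypothesis.Theorems.SymPencilSdcPerFourInnerRankH88

/-!
# Route `SymPencil` — no `8`-dimensional singular subspace of `per_4` carries a joint family with
# NINE squares: the cell `(8, 8, 9)` of the size `m = 26` is dead
# (`--supports` stmt-ValiantsHypothesis-5674 `SdcSuperquadratic`; rung currency only)

The subspace form of `SymPencilPerFourInnerRankTen.false_of_joint_nine_squares`, in the shape of
the cell hypotheses of `SymPencilSdcPerFourTwentySixReduction` (there `H88` has `8` squares; here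
any index type `ι` with `|ι| ≤ 9`, e.g. `Fin 9`): for `K` of characteristic `0`, an
`8`-dimensional `V ≤ K^{4×4}` on which all `3 × 3` subpermanents vanish, `c : ι → K` and bilinear
`β_r`, it is NOT the case that `per_4 (u + s y) = e₀ + e₁ s + s² Σ_r c_r β_r(u, y)²` for all `u`
and all `y ∈ V` (`not_joint_nine_squares`, `not_joint_nine_squares_fin`).

In the kernel package of a symmetric affine determinantal representation of `per_4` of size `m`
with `r = dim im bL = 8` (so `dim ker bL = 8`, a two-row block by BoxFour equality) the defect is
`d = m - 17`, and `SymPencilIsotropicKernelSquaresBilinear` delivers a joint family with `d`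
squares; `d = 9` is the size `m = 26`.  So of the size-`26` table the cells `(8,8,9)` (this file)
and `(9,7,7)` (`SymPencilPerFourLowRankSevenSharp`) are dead; `(10,6,5)` and `(12,4,1)` remain,
after the size-`25` cells `(10,6,4)` and `(12,4,0)`.

Proof: BoxFour equality, transport along row permutations / transposition (`joint_family_map`),
canonical position rows `0,1` zero, `s²`-coefficient (`SymPencilSdcPerFourInnerRankH88.
eval_rows01_add_smul_rows23`), then `false_of_joint_nine_squares`.  Honest framing: one cell of
one size; `sdc(per_4) ≥ 25` remains the tree's value (window `25 ≤ sdc(per₄) ≤ 29`); the crux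
`SdcSuperquadratic` and `VP ≠ VNP` are untouched.  No definitions, no named facts. [folklore]
-/

noncomputable section

-- single-conjunct layout: Sub = Summit, duplicated namespace component intended
set_option linter.dupNamespace false

namespace Summit.ValiantsHypothesis.ValiantsHypothesis.Theorems.SymPencilSdcPerFourInnerRankNineSquares

open Matrix MvPolynomial Finset Module
open Literature.Computability.AlgebraicComplexity
open Summit.ValiantsHypothesis.ValiantsHypothesis.Theorems.SymPencilPerFourBlocks
open Summit.ValiantsHypothesis.ValiantsHypothesis.Theorems.SymPencilPerFourTwoRowsRadical
open Summit.ValiantsHypothesis.ValiantsHypothesis.Theorems.SymPencilBoxFourEquality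
open Summit.ValiantsHypothesis.ValiantsHypothesis.Theorems.SymPencilPerFourInnerRankRows
open Summit.ValiantsHypothesis.ValiantsHypothesis.Theorems.SymPencilPerFourInnerRankTen
open Summit.ValiantsHypothesis.ValiantsHypothesis.Theorems.SymPencilSdcPerFourInnerRankH88
  (eval_rows01_add_smul_rows23)

variable {K : Type*} [Field K] {ι : Type*} [Fintype ι]

/-! ### Transport of a joint family along a `per_4`-preserving linear automorphism -/

/-- **Transport.**  If `V` carries a joint family `per_4 (u + s y) = e₀ + e₁ s + s² Σ c_k β_k(u,y)²`
(`y ∈ V`, all `u`) and `per_4 ∘ Φ = per_4`, then `Φ(V)` carries one with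
`β'_k(u, y) = β_k(Φ⁻¹ u, Φ⁻¹ y)`. [folklore] -/
theorem joint_family_map (V : Submodule K (Fin 4 × Fin 4 → K))
    (Φ : (Fin 4 × Fin 4 → K) ≃ₗ[K] (Fin 4 × Fin 4 → K))
    (hΦ : ∀ z, eval (Φ z) (perPoly (Fin 4) K) = eval z (perPoly (Fin 4) K)) (c : ι → K)
    (β : ι → ((Fin 4 × Fin 4 → K) →ₗ[K] (Fin 4 × Fin 4 → K) →ₗ[K] K))
    (h : ∀ u : Fin 4 × Fin 4 → K, ∀ y ∈ V, ∃ e₀ e₁ : K, ∀ s : K,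
      eval (u + s • y) (perPoly (Fin 4) K) = e₀ + s * e₁ + s ^ 2 * ∑ k, c k * (β k u y) ^ 2) :
    ∀ u : Fin 4 × Fin 4 → K, ∀ y ∈ V.map Φ.toLinearMap, ∃ e₀ e₁ : K, ∀ s : K,
      eval (u + s • y) (perPoly (Fin 4) K) = e₀ + s * e₁ + s ^ 2 *
        ∑ k, c k * ((β k).compl₁₂ Φ.symm.toLinearMap Φ.symm.toLinearMap u y) ^ 2 := by
  rintro u _ ⟨y, hy, rfl⟩
  obtain ⟨e₀, e₁, he⟩ := h (Φ.symm u) y hy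
  refine ⟨e₀, e₁, fun s => ?_⟩
  have hu : u + s • Φ.toLinearMap y = Φ (Φ.symm u + s • y) := by
    rw [map_add, map_smul, LinearEquiv.apply_symm_apply]; rfl
  rw [hu, hΦ, he s]
  simp only [LinearMap.compl₁₂_apply, LinearEquiv.coe_toLinearMap, LinearEquiv.symm_apply_apply]

/-! ### Canonical position: rows `0, 1` zero -/

/-- **Canonical position.**  If `V` (`dim 8`, rows `0, 1` zero) carries a joint `8`-square family,
contradiction: its `s²`-coefficients form a joint `8`-square family for the `2 | 2` row split of
`per_4`, excluded by `SymPencilPerFourInnerRankNine.false_of_joint_eight_squares`. [folklore] -/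
theorem false_of_joint_rows01 [CharZero K] [DecidableEq ι] (hι : Fintype.card ι ≤ 9)
    (V : Submodule K (Fin 4 × Fin 4 → K))
    (h8 : finrank K V = 8) (hV : ∀ x ∈ V, ∀ j, x (0, j) = 0 ∧ x (1, j) = 0) (c : ι → K)
    (β : ι → ((Fin 4 × Fin 4 → K) →ₗ[K] (Fin 4 × Fin 4 → K) →ₗ[K] K))
    (h : ∀ u : Fin 4 × Fin 4 → K, ∀ y ∈ V, ∃ e₀ e₁ : K, ∀ s : K,
      eval (u + s • y) (perPoly (Fin 4) K) = e₀ + s * e₁ + s ^ 2 * ∑ k, c k * (β k u y) ^ 2) :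
    False := by
  -- the two linear embeddings `(a, b) ↦ (a; b; 0; 0)` and `(y₂, y₃) ↦ (0; 0; y₂; y₃)`
  let EU : ((Fin 4 → K) × (Fin 4 → K)) →ₗ[K] (Fin 4 × Fin 4 → K) :=
    { toFun := fun ab p => if p.1 = 0 then ab.1 p.2 else if p.1 = 1 then ab.2 p.2 else 0
      map_add' := fun x y => by
        funext p
        simp only [Prod.fst_add, Prod.snd_add, Pi.add_apply]
        split_ifs <;> simp
      map_smul' := fun s x => by
        funext p
        simp only [Prod.smul_fst, Prod.smul_snd, Pi.smul_apply, smul_eq_mul, RingHom.id_apply]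
        split_ifs <;> simp }
  let EY : ((Fin 4 → K) × (Fin 4 → K)) →ₗ[K] (Fin 4 × Fin 4 → K) :=
    { toFun := fun y p => if p.1 = 2 then y.1 p.2 else if p.1 = 3 then y.2 p.2 else 0
      map_add' := fun x y => by
        funext p
        simp only [Prod.fst_add, Prod.snd_add, Pi.add_apply]
        split_ifs <;> simp
      map_smul' := fun s x => by
        funext p
        simp only [Prod.smul_fst, Prod.smul_snd, Pi.smul_apply, smul_eq_mul, RingHom.id_apply]
        split_ifs <;> simp }
  have hEU : ∀ a b : Fin 4 → K, EU (a, b) =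
      fun p : Fin 4 × Fin 4 => if p.1 = 0 then a p.2 else if p.1 = 1 then b p.2 else 0 :=
    fun a b => rfl
  have hEY : ∀ y₂ y₃ : Fin 4 → K, EY (y₂, y₃) =
      fun p : Fin 4 × Fin 4 => if p.1 = 2 then y₂ p.2 else if p.1 = 3 then y₃ p.2 else 0 :=
    fun y₂ y₃ => rfl
  have hmem : ∀ y₂ y₃ : Fin 4 → K, EY (y₂, y₃) ∈ V := fun y₂ y₃ =>
    mem_of_rows01 V h8 hV _ (fun j => by simp [hEY]) (fun j => by simp [hEY])
  let t : ι → (((Fin 4 → K) × (Fin 4 → K)) →ₗ[K] ((Fin 4 → K) × (Fin 4 → K)) →ₗ[K] K) :=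
    fun r => (β r).compl₁₂ EU EY
  refine false_of_joint_nine_squares hι c t fun a b y₂ y₃ => ?_
  obtain ⟨e₀, e₁, he⟩ := h (EU (a, b)) (EY (y₂, y₃)) (hmem y₂ y₃)
  have P : ∀ s : K, e₀ + s * e₁ + s ^ 2 * ∑ k, c k * (t k (a, b) (y₂, y₃)) ^ 2 =
      s ^ 2 * (Matrix.of ![a, b, y₂, y₃]).permanent := fun s => by
    have hs := he s
    have hev : eval (EU (a, b) + s • EY (y₂, y₃)) (perPoly (Fin 4) K) =
        (Matrix.of ![a, b, s • y₂, s • y₃]).permanent := by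
      rw [hEU, hEY]; exact eval_rows01_add_smul_rows23 a b y₂ y₃ s
    rw [hev, per_smul_row₂, per_smul_row₃] at hs
    rw [show ∑ k, c k * (t k (a, b) (y₂, y₃)) ^ 2 = ∑ k, c k * (β k (EU (a, b)) (EY (y₂, y₃))) ^ 2
      from rfl, ← hs]
    ring
  have h0 := P 0
  have h1 := P 1
  have h1' := P (-1)
  have h2 : (2 : K) * ∑ k, c k * (t k (a, b) (y₂, y₃)) ^ 2 =
      2 * (Matrix.of ![a, b, y₂, y₃]).permanent := by
    linear_combination h1 + h1' - 2 * h0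
  exact (mul_right_inj' two_ne_zero).1 h2

/-- **Two prescribed zero rows.** [folklore] -/
theorem false_of_joint_rows [CharZero K] [DecidableEq ι] (hι : Fintype.card ι ≤ 9)
    (V : Submodule K (Fin 4 × Fin 4 → K))
    (h8 : finrank K V = 8) {p q : Fin 4} (hpq : p ≠ q)
    (hV : ∀ x ∈ V, ∀ j, x (p, j) = 0 ∧ x (q, j) = 0) (c : ι → K)
    (β : ι → ((Fin 4 × Fin 4 → K) →ₗ[K] (Fin 4 × Fin 4 → K) →ₗ[K] K))
    (h : ∀ u : Fin 4 × Fin 4 → K, ∀ y ∈ V, ∃ e₀ e₁ : K, ∀ s : K,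
      eval (u + s • y) (perPoly (Fin 4) K) = e₀ + s * e₁ + s ^ 2 * ∑ k, c k * (β k u y) ^ 2) :
    False := by
  obtain ⟨σ, hσ0, hσ1⟩ := exists_perm_zero_one p q hpq
  set e := Equiv.prodCongr σ (1 : Equiv.Perm (Fin 4)) with he
  set Φ : (Fin 4 × Fin 4 → K) ≃ₗ[K] (Fin 4 × Fin 4 → K) := LinearEquiv.funCongrLeft K K e with hΦ
  have hΦa : ∀ (x : Fin 4 × Fin 4 → K) (i j : Fin 4), Φ x (i, j) = x (σ i, j) := fun x i j => by
    simp [hΦ, he]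
  have hΦper : ∀ z, eval (Φ z) (perPoly (Fin 4) K) = eval z (perPoly (Fin 4) K) := fun z => by
    have : (Φ z : Fin 4 × Fin 4 → K) = z ∘ e := rfl
    rw [this, he, eval_perPoly_comp_prodCongr]
  have h' := joint_family_map V Φ hΦper c β h
  set V' := V.map Φ.toLinearMap with hV'def
  have h8' : finrank K V' = 8 := by rw [hV'def, LinearEquiv.finrank_map_eq, h8]
  have hV' : ∀ y ∈ V', ∀ j, y (0, j) = 0 ∧ y (1, j) = 0 := by
    rintro _ ⟨x, hx, rfl⟩ j
    rw [LinearEquiv.coe_toLinearMap, hΦa, hΦa, hσ0, hσ1]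
    exact hV x hx j
  exact false_of_joint_rows01 hι V' h8' hV' c _ h'

/-- **Two prescribed zero rows or columns.** [folklore] -/
theorem false_of_joint_rows_or_cols [CharZero K] [DecidableEq ι] (hι : Fintype.card ι ≤ 9)
    (V : Submodule K (Fin 4 × Fin 4 → K))
    (h8 : finrank K V = 8)
    (hV : (∃ p q : Fin 4, p ≠ q ∧ ∀ x ∈ V, ∀ j, x (p, j) = 0 ∧ x (q, j) = 0) ∨
      (∃ p q : Fin 4, p ≠ q ∧ ∀ x ∈ V, ∀ i, x (i, p) = 0 ∧ x (i, q) = 0)) (c : ι → K)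
    (β : ι → ((Fin 4 × Fin 4 → K) →ₗ[K] (Fin 4 × Fin 4 → K) →ₗ[K] K))
    (h : ∀ u : Fin 4 × Fin 4 → K, ∀ y ∈ V, ∃ e₀ e₁ : K, ∀ s : K,
      eval (u + s • y) (perPoly (Fin 4) K) = e₀ + s * e₁ + s ^ 2 * ∑ k, c k * (β k u y) ^ 2) :
    False := by
  rcases hV with ⟨p, q, hpq, hV⟩ | ⟨p, q, hpq, hV⟩
  · exact false_of_joint_rows hι V h8 hpq hV c β h
  · -- transpose, then the row case
    set Φ : (Fin 4 × Fin 4 → K) ≃ₗ[K] (Fin 4 × Fin 4 → K) :=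
      LinearEquiv.funCongrLeft K K (Equiv.prodComm (Fin 4) (Fin 4)) with hΦ
    have hΦa : ∀ (x : Fin 4 × Fin 4 → K) (i j : Fin 4), Φ x (i, j) = x (j, i) := fun x i j => rfl
    have h' := joint_family_map V Φ eval_perPoly_transpose c β h
    set V' := V.map Φ.toLinearMap with hV'def
    have h8' : finrank K V' = 8 := by rw [hV'def, LinearEquiv.finrank_map_eq, h8]
    have hV' : ∀ y ∈ V', ∀ j, y (p, j) = 0 ∧ y (q, j) = 0 := by
      rintro _ ⟨x, hx, rfl⟩ j
      rw [LinearEquiv.coe_toLinearMap, hΦa, hΦa]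
      exact hV x hx j
    exact false_of_joint_rows hι V' h8' hpq hV' c _ h'

/-! ### Nine squares along an `8`-dimensional singular subspace -/

/-- **No `8`-dimensional subspace of `Sing Z(per_4)` carries a joint family with at most nine
squares** (any index type `ι`, `|ι| ≤ 9`; characteristic `0`). [folklore] -/
theorem not_joint_nine_squares [CharZero K] [DecidableEq ι] (hι : Fintype.card ι ≤ 9) :
    ∀ V : Submodule K (Fin 4 × Fin 4 → K),
      (∀ x ∈ V, ∀ (r c : Fin 3 → Fin 4), Function.Injective r → Function.Injective c →
        ((Matrix.of fun i j => x (i, j)).submatrix r c).permanent = 0) →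
      finrank K V = 8 → ∀ (c : ι → K)
        (β : ι → ((Fin 4 × Fin 4 → K) →ₗ[K] (Fin 4 × Fin 4 → K) →ₗ[K] K)),
      ¬ (∀ u : Fin 4 × Fin 4 → K, ∀ y ∈ V, ∃ e₀ e₁ : K, ∀ s : K,
          eval (u + s • y) (perPoly (Fin 4) K) = e₀ + s * e₁ + s ^ 2 * ∑ k, c k * (β k u y) ^ 2) :=
  fun V hV h8 c β h => false_of_joint_rows_or_cols hι V h8 (two_rows_or_two_cols V hV h8) c β h

/-- **The `Fin 9` instance**: no `8`-dimensional singular subspace of `per_4` carries a joint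
`9`-square family — the cell `(8, 8, 9)` of the size `m = 26`. [folklore] -/
theorem not_joint_nine_squares_fin (K : Type*) [Field K] [CharZero K] :
    ∀ V : Submodule K (Fin 4 × Fin 4 → K),
      (∀ x ∈ V, ∀ (r c : Fin 3 → Fin 4), Function.Injective r → Function.Injective c →
        ((Matrix.of fun i j => x (i, j)).submatrix r c).permanent = 0) →
      finrank K V = 8 → ∀ (c : Fin 9 → K)
        (β : Fin 9 → ((Fin 4 × Fin 4 → K) →ₗ[K] (Fin 4 × Fin 4 → K) →ₗ[K] K)),
      ¬ (∀ u : Fin 4 × Fin 4 → K, ∀ y ∈ V, ∃ e₀ e₁ : K, ∀ s : K,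
          eval (u + s • y) (perPoly (Fin 4) K) = e₀ + s * e₁ + s ^ 2 * ∑ k, c k * (β k u y) ^ 2) :=
  not_joint_nine_squares (by rw [Fintype.card_fin])

end Summit.ValiantsHypothesis.ValiantsHypothesis.Theorems.SymPencilSdcPerFourInnerRankNineSquares

end
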